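import Literature.MathematicalPhysics.QuantumFieldTheory.TorusLoopReflection
import HarnessLib

/-!
# Rectangular Wilson loops cut by the reflection hyperplane between time slices: staples

Bookkeeping for the reflection-positivity ("log-convexity") inequalities between rectangular
Wilson loop expectations of the torus Wilson states (used for the named fact
`exists_hasStringTension` of `LatticeGauge`, via
`StringTension.hasStringTension_of_eventually`). We work on the torus `(ℤ/Lℤ)^d` of Wave 0
(`GaugeConfig d L G`, time = coordinate `0`) with the reflection `θ t = 1 - t` in the hyperplane
between the time slices `0 | 1` (`Site.timeReflect`, `GaugeConfig.timeReflect`, whose reflection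
positivity is the tree's `wilsonExpectation_reflectionPositive_holds`).

A rectangular loop of time-like extent `h₁ + 1 + h₂` placed symmetrically about the hyperplane —
`h₁` links below the slice `0`, the crossing link `0 → 1`, `h₂` links above the slice `1` — is,
up to conjugation, the product `Φ_{h₂}(U) · Φ_{h₁}(ΘU)⁻¹` of the **extended staple**
`Φ_h(U) = P(a → a + (h+1)e₀) P(a + (h+1)e₀ → a + (h+1)e₀ + m eⱼ) P(a + m eⱼ → a + m eⱼ + (h+1)e₀)⁻¹`
(base point `a` in the slice `t = 0`; it contains the two crossing links) and the reflected
extended staple. This file proves that identity in the form needed after Osterwalder–Seiler's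
splitting of the crossing links (`WilsonRP.translate`, `LatticeRP.splice`): for configurations
`V` ("translated") and `z` ("spliced") that agree with `U` on the relevant non-crossing links and
carry `U_c Y_c` resp. `Y_c` on the two crossing links `c`,
`hol_{rect}(V) = κ · Φ_{h₂}(z) · Φ_{h₁}(ΘU)⁻¹ · κ⁻¹` (`rectangleHolonomy_eq_conj_staples`), hence
`Re tr ρ(hol_{rect}(V)) = ∑_{ab} Re (σ(Φ_{h₂}(z))_{ab} conj σ(Φ_{h₁}(ΘU))_{ab})` for the unitarised
representation `σ` (`re_trace_rectangleHolonomy_eq_sum`). The hypotheses on `V, z` are discharged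
from the classification of links in the parity-specific files. Everything here is proved.

## Contents

* site arithmetic in the time direction (`timeReflect_add_single`, …);
* the reflection on lines: `lineHolonomy_timeReflect_of_ne_zero` (spatial lines are carried to
  the reflected slice), `lineHolonomy_timeReflect_zero` (a time-like line starting in the slice
  `0` goes to the inverse of the mirror line ending in the slice `1`);
* `rectangleHolonomy_eq_split` (cutting the rectangle at the slice `0`),
  `staple_timeReflect` (the reflected extended staple), `rectangleHolonomy_eq_conj_staples`,
  `re_trace_rectangleHolonomy_eq_sum`.

## References

* K. Osterwalder, E. Seiler, Ann. Phys. 110 (1978) 440, §2; E. Seiler, LNP 159 (1982), §2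
  (static potential from reflection positivity: the loop as a scalar product of staples).
-/

noncomputable section

open MeasureTheory Finset Complex

namespace Literature.MathematicalPhysics.QuantumFieldTheory

namespace StringTension

variable {d L : ℕ} [NeZero d] {G : Type*} [Group G]

/-! ### Site arithmetic in the time direction -/

/-- Reflection of a site of the time slice `t` above a base point `a` of the slice `0`:
`θ(a + t e₀) = a + (1 - t) e₀`. [folklore] -/
theorem timeReflect_add_single {a : Site d L} (ha : a 0 = 0) (t : ZMod L) :
    (a + Pi.single 0 t).timeReflect = a + Pi.single 0 (1 - t) := by
  funext k
  by_cases hk : k = 0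
  · subst hk
    simp [Site.timeReflect, ha]
  · simp [Site.timeReflect, hk]

/-- `θ(a + t e₀ + e₀) = a - t e₀` for a base point `a` of the slice `0`. [folklore] -/
theorem timeReflect_shift_add_single {a : Site d L} (ha : a 0 = 0) (t : ZMod L) :
    ((a + Pi.single 0 t).shift 0).timeReflect = a + Pi.single 0 (-t) := by
  have h : (a + Pi.single 0 t).shift 0 = a + Pi.single (0 : Fin d) (t + 1) := by
    simp only [Site.shift, add_assoc, ← Pi.single_add]
  rw [h, timeReflect_add_single ha]
  congr 2
  ring

/-- `θ(a + e₀) = a` for a base point `a` of the slice `0`. [folklore] -/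
theorem timeReflect_shift_of_zero {a : Site d L} (ha : a 0 = 0) : (a.shift 0).timeReflect = a := by
  have := timeReflect_shift_add_single ha 0
  simp only [Pi.single_zero, add_zero, neg_zero] at this
  exact this

omit [NeZero d] in
/-- Time-like and spatial displacements commute. [folklore] -/
theorem add_single_add_single_comm (a : Site d L) (i j : Fin d) (s t : ZMod L) :
    a + Pi.single i s + Pi.single j t = a + Pi.single j t + Pi.single i s :=
  add_right_comm _ _ _

omit [NeZero d] in
/-- Two displacements in the same direction add. [folklore] -/
theorem add_single_add_single_same (a : Site d L) (i : Fin d) (s t : ZMod L) :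
    a + Pi.single i s + Pi.single i t = a + Pi.single i (s + t) := by
  rw [add_assoc, ← Pi.single_add]

/-- A spatially displaced base point stays in the slice `0`. [folklore] -/
theorem add_single_apply_zero_of_ne {a : Site d L} (ha : a 0 = 0) {j : Fin d} (hj : j ≠ 0)
    (s : ZMod L) : (a + Pi.single j s : Site d L) 0 = 0 := by
  rw [Pi.add_apply, ha, Pi.single_eq_of_ne (Ne.symm hj), add_zero]

/-! ### The reflection on lines -/

/-- **Spatial lines are carried to the reflected slice**: for a spatial direction `j`,
`P_{ΘU}(y → y + n eⱼ) = P_U(θy → θy + n eⱼ)`. [folklore] -/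
theorem lineHolonomy_timeReflect_of_ne_zero (U : GaugeConfig d L G) {j : Fin d} (hj : j ≠ 0) :
    ∀ (n : ℕ) (y : Site d L),
      lineHolonomy U.timeReflect j n y = lineHolonomy U j n y.timeReflect
  | 0, _ => rfl
  | n + 1, y => by
      rw [lineHolonomy_succ, lineHolonomy_succ, lineHolonomy_timeReflect_of_ne_zero U hj n,
        WilsonRP.timeReflect_apply, WilsonRP.timeReflect_shift_of_ne _ hj]
      simp [WilsonRP.edgeReflect, hj]

/-- **A time-like line starting in the slice `0` is carried to the inverse of its mirror image**:
`P_{ΘU}(a → a + (h+1) e₀) = P_U(a - h e₀ → a + e₀)⁻¹` for `a` in the slice `0`. [folklore] -/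
theorem lineHolonomy_timeReflect_zero (U : GaugeConfig d L G) {a : Site d L} (ha : a 0 = 0) :
    ∀ h : ℕ, lineHolonomy U.timeReflect 0 (h + 1) a =
      (lineHolonomy U 0 (h + 1) (a + Pi.single 0 (-((h : ℕ) : ZMod L))))⁻¹
  | 0 => by
      rw [lineHolonomy_succ, lineHolonomy_zero, mul_one, lineHolonomy_succ, lineHolonomy_zero,
        mul_one, WilsonRP.timeReflect_apply]
      simp only [WilsonRP.edgeReflect, ↓reduceIte, Nat.cast_zero, neg_zero, Pi.single_zero,
        add_zero, timeReflect_shift_of_zero ha]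
  | h + 1 => by
      have hs : (a + Pi.single 0 (-(((h + 1 : ℕ)) : ZMod L)) : Site d L).shift 0 =
          a + Pi.single 0 (-((h : ℕ) : ZMod L)) := by
        simp only [Site.shift, add_assoc, ← Pi.single_add]
        congr 2; push_cast; ring
      have key : lineHolonomy U 0 (h + 1 + 1) (a + Pi.single 0 (-(((h + 1 : ℕ)) : ZMod L))) =
          U (a + Pi.single 0 (-(((h + 1 : ℕ)) : ZMod L)), 0) *
            lineHolonomy U 0 (h + 1) (a + Pi.single 0 (-((h : ℕ) : ZMod L))) := by
        rw [lineHolonomy_succ, hs]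
      rw [lineHolonomy_succ_right, lineHolonomy_timeReflect_zero U ha h, WilsonRP.timeReflect_apply]
      simp only [WilsonRP.edgeReflect, ↓reduceIte]
      rw [timeReflect_shift_add_single ha, ← mul_inv_rev]
      exact (congrArg (·⁻¹) key).symm

/-! ### Cutting the rectangle at the slice `0` -/

/-- **The rectangle split at the slice `0`.** The rectangular loop with `h₁ + (h₂ + 1)` time-like
and `m` spatial steps based at `x = a - h₁ e₀` is
`P(x → a) · [P(a → a + (h₂+1)e₀) P(→ + m eⱼ) P(a + m eⱼ → a + m eⱼ + (h₂+1)e₀)⁻¹] ·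
P(x + m eⱼ → a + m eⱼ)⁻¹ · P(x → x + m eⱼ)⁻¹` (pure bookkeeping, any configuration). [folklore] -/
theorem rectangleHolonomy_eq_split (V : GaugeConfig d L G) (a : Site d L) (j : Fin d)
    (h₁ h₂ m : ℕ) :
    rectangleHolonomy V (a + Pi.single 0 (-((h₁ : ℕ) : ZMod L))) 0 j (h₁ + (h₂ + 1)) m =
      lineHolonomy V 0 h₁ (a + Pi.single 0 (-((h₁ : ℕ) : ZMod L))) *
        (lineHolonomy V 0 (h₂ + 1) a *
          lineHolonomy V j m (a + Pi.single 0 (((h₂ + 1 : ℕ)) : ZMod L)) *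
          (lineHolonomy V 0 (h₂ + 1) (a + Pi.single j ((m : ℕ) : ZMod L)))⁻¹) *
        (lineHolonomy V 0 h₁ (a + Pi.single 0 (-((h₁ : ℕ) : ZMod L)) +
          Pi.single j ((m : ℕ) : ZMod L)))⁻¹ *
        (lineHolonomy V j m (a + Pi.single 0 (-((h₁ : ℕ) : ZMod L))))⁻¹ := by
  have e1 : a + Pi.single 0 (-((h₁ : ℕ) : ZMod L)) + Pi.single 0 ((h₁ : ℕ) : ZMod L) = a := by
    rw [add_single_add_single_same]; simp
  have e2 : a + Pi.single 0 (-((h₁ : ℕ) : ZMod L)) + Pi.single (0 : Fin d)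
      (((h₁ + (h₂ + 1) : ℕ)) : ZMod L) = a + Pi.single 0 (((h₂ + 1 : ℕ)) : ZMod L) := by
    rw [add_single_add_single_same]; congr 2; push_cast; ring
  have e3 : a + Pi.single 0 (-((h₁ : ℕ) : ZMod L)) + Pi.single j ((m : ℕ) : ZMod L) +
      Pi.single 0 ((h₁ : ℕ) : ZMod L) = a + Pi.single j ((m : ℕ) : ZMod L) := by
    rw [add_single_add_single_comm, add_single_add_single_same]; simp
  unfold rectangleHolonomy
  rw [lineHolonomy_add V 0 h₁ (h₂ + 1), lineHolonomy_add V 0 h₁ (h₂ + 1), e1, e2, e3]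
  simp only [mul_inv_rev, mul_assoc]

/-! ### The reflected extended staple and the conjugation identity -/

variable {a : Site d L} {j : Fin d}

/-- **The reflected extended staple.** For `a` in the slice `0` and a spatial direction `j`,
`Φ_h(ΘU) = (P(x → a) U(a,0))⁻¹ · P_U(x → x + m eⱼ) · (P(x + m eⱼ → a + m eⱼ) U(a + m eⱼ, 0))`,
`x = a - h e₀`: the reflection carries the staple above the hyperplane to the inverse staple
below it, including the two crossing links. [folklore] -/
theorem staple_timeReflect (U : GaugeConfig d L G) (ha : a 0 = 0) (hj : j ≠ 0) (h m : ℕ) :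
    lineHolonomy U.timeReflect 0 (h + 1) a *
        lineHolonomy U.timeReflect j m (a + Pi.single 0 (((h + 1 : ℕ)) : ZMod L)) *
        (lineHolonomy U.timeReflect 0 (h + 1) (a + Pi.single j ((m : ℕ) : ZMod L)))⁻¹ =
      (lineHolonomy U 0 (h + 1) (a + Pi.single 0 (-((h : ℕ) : ZMod L))))⁻¹ *
        lineHolonomy U j m (a + Pi.single 0 (-((h : ℕ) : ZMod L))) *
        lineHolonomy U 0 (h + 1) (a + Pi.single 0 (-((h : ℕ) : ZMod L)) +
          Pi.single j ((m : ℕ) : ZMod L)) := by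
  have ha' : (a + Pi.single j ((m : ℕ) : ZMod L) : Site d L) 0 = 0 :=
    add_single_apply_zero_of_ne ha hj _
  rw [lineHolonomy_timeReflect_zero U ha h, lineHolonomy_timeReflect_zero U ha' h, inv_inv,
    lineHolonomy_timeReflect_of_ne_zero U hj, timeReflect_add_single ha,
    add_single_add_single_comm a j 0]
  congr 3
  · congr 2; push_cast; ring

/-- **The rectangle as a conjugate of `Φ_{h₂}(z) Φ_{h₁}(ΘU)⁻¹`.** Let `a` lie in the slice `0`,
`j ≠ 0`, `x = a - h₁ e₀`, and let `V, z` be configurations such that: `V` agrees with `U` on the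
links of the three lines `P(x → a - e₀ … )` of length `h₁` from `x` and from `x + m eⱼ` and the
spatial line from `x` (hypotheses `hk, hk', hℓ`); on the two crossing links `c = (a, 0)`,
`c' = (a + m eⱼ, 0)` one has `V_c = U_c Y_c`, `V_{c'} = U_{c'} Y_{c'}`, `z_c = Y_c`,
`z_{c'} = Y_{c'}`; and the upper staples of `V` and `z` agree (`hG`). Then
`hol_rect(V) = κ (Φ_{h₂}(z) Φ_{h₁}(ΘU)⁻¹) κ⁻¹` with `κ = P_U(x → a) U_c`. In the application `V`
is Osterwalder–Seiler's translated configuration `translate Y U` and `z = splice_C(U, Y)`.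
[folklore] -/
theorem rectangleHolonomy_eq_conj_staples (U V z Y : GaugeConfig d L G) (ha : a 0 = 0)
    (hj : j ≠ 0) (h₁ h₂ m : ℕ)
    (hk : lineHolonomy V 0 h₁ (a + Pi.single 0 (-((h₁ : ℕ) : ZMod L))) =
      lineHolonomy U 0 h₁ (a + Pi.single 0 (-((h₁ : ℕ) : ZMod L))))
    (hk' : lineHolonomy V 0 h₁ (a + Pi.single 0 (-((h₁ : ℕ) : ZMod L)) +
        Pi.single j ((m : ℕ) : ZMod L)) =
      lineHolonomy U 0 h₁ (a + Pi.single 0 (-((h₁ : ℕ) : ZMod L)) + Pi.single j ((m : ℕ) : ZMod L)))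
    (hℓ : lineHolonomy V j m (a + Pi.single 0 (-((h₁ : ℕ) : ZMod L))) =
      lineHolonomy U j m (a + Pi.single 0 (-((h₁ : ℕ) : ZMod L))))
    (hc : V (a, 0) = U (a, 0) * Y (a, 0))
    (hc' : V (a + Pi.single j ((m : ℕ) : ZMod L), 0) =
      U (a + Pi.single j ((m : ℕ) : ZMod L), 0) * Y (a + Pi.single j ((m : ℕ) : ZMod L), 0))
    (hzc : z (a, 0) = Y (a, 0))
    (hzc' : z (a + Pi.single j ((m : ℕ) : ZMod L), 0) = Y (a + Pi.single j ((m : ℕ) : ZMod L), 0))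
    (hG : lineHolonomy V 0 h₂ (a.shift 0) *
        lineHolonomy V j m (a + Pi.single 0 (((h₂ + 1 : ℕ)) : ZMod L)) *
        (lineHolonomy V 0 h₂ ((a + Pi.single j ((m : ℕ) : ZMod L)).shift 0))⁻¹ =
      lineHolonomy z 0 h₂ (a.shift 0) *
        lineHolonomy z j m (a + Pi.single 0 (((h₂ + 1 : ℕ)) : ZMod L)) *
        (lineHolonomy z 0 h₂ ((a + Pi.single j ((m : ℕ) : ZMod L)).shift 0))⁻¹) :
    rectangleHolonomy V (a + Pi.single 0 (-((h₁ : ℕ) : ZMod L))) 0 j (h₁ + (h₂ + 1)) m =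
      (lineHolonomy U 0 h₁ (a + Pi.single 0 (-((h₁ : ℕ) : ZMod L))) * U (a, 0)) *
        ((lineHolonomy z 0 (h₂ + 1) a *
            lineHolonomy z j m (a + Pi.single 0 (((h₂ + 1 : ℕ)) : ZMod L)) *
            (lineHolonomy z 0 (h₂ + 1) (a + Pi.single j ((m : ℕ) : ZMod L)))⁻¹) *
          (lineHolonomy U.timeReflect 0 (h₁ + 1) a *
            lineHolonomy U.timeReflect j m (a + Pi.single 0 (((h₁ + 1 : ℕ)) : ZMod L)) *
            (lineHolonomy U.timeReflect 0 (h₁ + 1) (a + Pi.single j ((m : ℕ) : ZMod L)))⁻¹)⁻¹) *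
        (lineHolonomy U 0 h₁ (a + Pi.single 0 (-((h₁ : ℕ) : ZMod L))) * U (a, 0))⁻¹ := by
  -- the lower lines of length `h₁ + 1` end with the crossing links
  have hlow : lineHolonomy U 0 (h₁ + 1) (a + Pi.single 0 (-((h₁ : ℕ) : ZMod L))) =
      lineHolonomy U 0 h₁ (a + Pi.single 0 (-((h₁ : ℕ) : ZMod L))) * U (a, 0) := by
    rw [lineHolonomy_succ_right, add_single_add_single_same]; simp
  have hlow' : lineHolonomy U 0 (h₁ + 1) (a + Pi.single 0 (-((h₁ : ℕ) : ZMod L)) +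
        Pi.single j ((m : ℕ) : ZMod L)) =
      lineHolonomy U 0 h₁ (a + Pi.single 0 (-((h₁ : ℕ) : ZMod L)) + Pi.single j ((m : ℕ) : ZMod L)) *
        U (a + Pi.single j ((m : ℕ) : ZMod L), 0) := by
    rw [lineHolonomy_succ_right, add_single_add_single_comm, add_single_add_single_same]; simp
  -- the staples of `V` and `z` start with the crossing links
  have hV : lineHolonomy V 0 (h₂ + 1) a * lineHolonomy V j m (a + Pi.single 0 (((h₂ + 1 : ℕ)) : ZMod L)) *
      (lineHolonomy V 0 (h₂ + 1) (a + Pi.single j ((m : ℕ) : ZMod L)))⁻¹ =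
      U (a, 0) * Y (a, 0) * (lineHolonomy z 0 h₂ (a.shift 0) *
        lineHolonomy z j m (a + Pi.single 0 (((h₂ + 1 : ℕ)) : ZMod L)) *
        (lineHolonomy z 0 h₂ ((a + Pi.single j ((m : ℕ) : ZMod L)).shift 0))⁻¹) *
        (U (a + Pi.single j ((m : ℕ) : ZMod L), 0) * Y (a + Pi.single j ((m : ℕ) : ZMod L), 0))⁻¹ := by
    rw [lineHolonomy_succ, lineHolonomy_succ, hc, hc', ← hG]
    simp only [mul_inv_rev, mul_assoc]
  have hz : lineHolonomy z 0 (h₂ + 1) a * lineHolonomy z j m (a + Pi.single 0 (((h₂ + 1 : ℕ)) : ZMod L)) *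
      (lineHolonomy z 0 (h₂ + 1) (a + Pi.single j ((m : ℕ) : ZMod L)))⁻¹ =
      Y (a, 0) * (lineHolonomy z 0 h₂ (a.shift 0) *
        lineHolonomy z j m (a + Pi.single 0 (((h₂ + 1 : ℕ)) : ZMod L)) *
        (lineHolonomy z 0 h₂ ((a + Pi.single j ((m : ℕ) : ZMod L)).shift 0))⁻¹) *
        (Y (a + Pi.single j ((m : ℕ) : ZMod L), 0))⁻¹ := by
    rw [lineHolonomy_succ, lineHolonomy_succ, hzc, hzc']
    simp only [mul_inv_rev, mul_assoc]
  rw [rectangleHolonomy_eq_split, staple_timeReflect U ha hj, hk, hk', hℓ, hV, hz, hlow, hlow']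
  group

end StringTension

/-! ### The trace form -/

namespace StringTension

variable {d L N : ℕ} [NeZero d] {G : Type*} [Group G] [TopologicalSpace G] [IsTopologicalGroup G]
  [CompactSpace G] (ρ : G →* Matrix (Fin N) (Fin N) ℂ)

/-- **The loop as a scalar product of staples.** Under the hypotheses of
`rectangleHolonomy_eq_conj_staples`,
`Re tr ρ(hol_rect(V)) = ∑_{a,b} Re (σ(Φ_{h₂}(z))_{ab} · conj σ(Φ_{h₁}(ΘU))_{ab})` for the
unitarised representation `σ` of the continuous representation `ρ` (Weyl's unitarian trick,
`CompactGroup.re_trace_mul_inv_eq_sum`): the Wilson loop cut by the reflection hyperplane is the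
entrywise scalar product of the staple above the plane with the reflected staple
(Osterwalder–Seiler 1978 §2; Seiler LNP 159 §2). [folklore] -/
theorem re_trace_rectangleHolonomy_eq_sum (hρ : Continuous ρ) (U V z Y : GaugeConfig d L G)
    {a : Site d L} {j : Fin d} (ha : a 0 = 0) (hj : j ≠ 0) (h₁ h₂ m : ℕ)
    (hk : lineHolonomy V 0 h₁ (a + Pi.single 0 (-((h₁ : ℕ) : ZMod L))) =
      lineHolonomy U 0 h₁ (a + Pi.single 0 (-((h₁ : ℕ) : ZMod L))))
    (hk' : lineHolonomy V 0 h₁ (a + Pi.single 0 (-((h₁ : ℕ) : ZMod L)) +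
        Pi.single j ((m : ℕ) : ZMod L)) =
      lineHolonomy U 0 h₁ (a + Pi.single 0 (-((h₁ : ℕ) : ZMod L)) + Pi.single j ((m : ℕ) : ZMod L)))
    (hℓ : lineHolonomy V j m (a + Pi.single 0 (-((h₁ : ℕ) : ZMod L))) =
      lineHolonomy U j m (a + Pi.single 0 (-((h₁ : ℕ) : ZMod L))))
    (hc : V (a, 0) = U (a, 0) * Y (a, 0))
    (hc' : V (a + Pi.single j ((m : ℕ) : ZMod L), 0) =
      U (a + Pi.single j ((m : ℕ) : ZMod L), 0) * Y (a + Pi.single j ((m : ℕ) : ZMod L), 0))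
    (hzc : z (a, 0) = Y (a, 0))
    (hzc' : z (a + Pi.single j ((m : ℕ) : ZMod L), 0) = Y (a + Pi.single j ((m : ℕ) : ZMod L), 0))
    (hG : lineHolonomy V 0 h₂ (a.shift 0) *
        lineHolonomy V j m (a + Pi.single 0 (((h₂ + 1 : ℕ)) : ZMod L)) *
        (lineHolonomy V 0 h₂ ((a + Pi.single j ((m : ℕ) : ZMod L)).shift 0))⁻¹ =
      lineHolonomy z 0 h₂ (a.shift 0) *
        lineHolonomy z j m (a + Pi.single 0 (((h₂ + 1 : ℕ)) : ZMod L)) *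
        (lineHolonomy z 0 h₂ ((a + Pi.single j ((m : ℕ) : ZMod L)).shift 0))⁻¹) :
    ((ρ (rectangleHolonomy V (a + Pi.single 0 (-((h₁ : ℕ) : ZMod L))) 0 j (h₁ + (h₂ + 1)) m)).trace).re =
      ∑ k, ∑ l,
        (Literature.RepresentationTheory.CompactGroups.CompactGroup.unitarize ρ hρ
            (lineHolonomy z 0 (h₂ + 1) a *
              lineHolonomy z j m (a + Pi.single 0 (((h₂ + 1 : ℕ)) : ZMod L)) *
              (lineHolonomy z 0 (h₂ + 1) (a + Pi.single j ((m : ℕ) : ZMod L)))⁻¹) k l *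
          (starRingEnd ℂ) (Literature.RepresentationTheory.CompactGroups.CompactGroup.unitarize ρ hρ
            (lineHolonomy U.timeReflect 0 (h₁ + 1) a *
              lineHolonomy U.timeReflect j m (a + Pi.single 0 (((h₁ + 1 : ℕ)) : ZMod L)) *
              (lineHolonomy U.timeReflect 0 (h₁ + 1) (a + Pi.single j ((m : ℕ) : ZMod L)))⁻¹) k l)).re := by
  rw [rectangleHolonomy_eq_conj_staples U V z Y ha hj h₁ h₂ m hk hk' hℓ hc hc' hzc hzc' hG,
    Literature.RepresentationTheory.CompactGroups.CompactGroup.trace_conj_eq,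
    Literature.RepresentationTheory.CompactGroups.CompactGroup.re_trace_mul_inv_eq_sum ρ hρ]

end StringTension

end Literature.MathematicalPhysics.QuantumFieldTheory
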